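import Summits.AtomisticToContinuum.HydrodynamicLimit.Theorems.InformationPercolationEngineChaosClosesEulerShellFieldC
import Summits.AtomisticToContinuum.HydrodynamicLimit.Theorems.InformationPercolationEngineChaosClosesEulerShellL1Int
import HarnessLib

/-!
# BF18 shell for functions (crux `ChaosClosesEuler`, stmt-AtomisticToContinuum-15141, line `Sketch`,
# stub `stub_bf18Shell`) — assembly, core lemma C: coercivity (`stub_bf18ShellCoreC`)

WHAT. The last step of the deterministic Březina–Feireisl relative-energy shell of the line. Setting (shared
header of the three core lemmas of the assembly): a classical solution `(ρ, u, θ)` on `[0, T)` of the Euler system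
for `eos = EulerEOS.monatomicExcess χe f`, horizons `0 < t < t' < T`, bounds `M, N, P` of the data on `[0, t']`, the
compact thermodynamic range `K` with `δK < ρ, θ` on it, the pointwise package `hpack` of the shell (of which only
conjuncts 2–4 are used here: `0 ≤ ℰ` and the NEAR / FAR coercivity of the clamped relative energy
`ℰ(s, x) = ℰ_{Zs}(w(V s x) | pdAt (s, x))` of the shell state `w(V) = (ϱ, E - |m|²/(2ϱ), m)` of a measurable bounded
admissible shell field `V = (ϱ, m, E)`), the `L¹` conversion clause `hL` (one constant `L` turning the two
coercivity regimes into `D ≤ L (X + √X)` for the distance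
`D = |ϱ - r| + ‖m - rU‖ + |E - r(‖U‖²/2 + 3Θ/2)|`), a function `Fm = F` on `[0, t]`, `F(s) = ∫ₓ ℰ(s, x)`, and a
window `[τ₀, τ₀ + Δ] ⊆ [0, t]` on which `∫ F ≤ Δ Γ`.

* `dist_le_of_regimes`: POINTWISE, `D(s, x) ≤ L (ℰ(s, x) + √ℰ(s, x))` — the package's near/far conjuncts are fed to
  `hL` after identifying the shell temperature (`stateTemp_shell`), the total energy (`totalEnergy_shell`), the
  vacuum (`mom_shell_eq_zero`) and `∑ᵢ (mᵢ - ϱUᵢ)² = ‖m - ϱU‖²` (`norm_sub_smul_sq`);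
* `le_mul_sqrt_of_forall` (= the registered `stub_bf18ShellCoreC`): `I ≤ (λΔ + ΔΓ/λ)/2` for all `λ > 0` gives
  `I ≤ Δ√Γ` (`λ = √Γ`; `Γ = 0` by `λ → 0`);
* `strip_integral_le`: on the strip `S = [τ₀, τ₀ + Δ] × 𝕋³`, `D ≤ L(ℰ + √ℰ)`, `ℰ ≥ 0`, `∫∫_S ℰ ≤ ΔΓ` give
  `∫∫_S D ≤ Δ · L (Γ + √Γ)` (monotonicity, `∫ √ℰ ≤ (λ|S| + ∫ℰ/λ)/2` from `integral_sqrt_le_of_ae`, `|S| = Δ`);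
* `coreC`: the conclusion `∫_{τ₀}^{τ₀+Δ} ∫ₓ D ≤ Δ (L (Γ + √Γ))`, the strip integrals being the iterated ones by
  `strip_pack` (`field_L1`, `field_relEnergy`).

WHY. Part C of the assembly of `stub_bf18Shell`: parts A (the slice functional and its initial value) and B (the
weighted inequality and the windowed Grönwall lemma) produce the window bound `∫_{τ₀}^{τ₀+Δ} F ≤ Δ Γ`; coercivity
turns it into the shell's `L¹` conclusion.

No named fact is invoked.
-/

noncomputable section

namespace Summit.AtomisticToContinuum.HydrodynamicLimit.Theorems.ChaosClosesEulerShellCoreC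

open Set MeasureTheory Function
open scoped InnerProductSpace BigOperators
open Literature.MathematicalPhysics.KineticTheory (T3 V3 totalEnergyDensity)
open Literature.Analysis.FluidPDE Literature.Analysis.FluidPDE.CompressibleEuler
open Literature.Analysis.FluidPDE.CompressibleEuler.StrongPointData
open Literature.Analysis.FunctionSpaces

/-! ## §1 Pointwise: the two coercivity regimes give the `L¹` distance -/

/-- **Pointwise conversion.** For reference data `d` with `δK ≤ r ≤ P`, `0 ≤ Θ ≤ P`, `‖U‖ ≤ P`, an admissible
shell state `U = (ϱ, m, E)` (`ϱ, E ≥ 0`, `|m|² ≤ 2ϱE`) and a level `X ≥ 0` dominating the NEAR regime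
(`ϱ > 0`, `|ϱ - r| ≤ δK`, `|ϑ(w U) - Θ| ≤ δK`: `c((ϱ-r)² + (ϑ-Θ)²) + ∑ᵢ(mᵢ - ϱUᵢ)²/(2ϱ) ≤ X`) and the FAR regime
(otherwise: `c(1 + ϱ + E + ∑ᵢ(mᵢ - ϱUᵢ)²/(2ϱ)) ≤ X`), the `L¹` conversion clause `hL` yields
`|ϱ - r| + ‖m - rU‖ + |E - r(‖U‖²/2 + 3Θ/2)| ≤ L (X + √X)` (the shell temperature is `θo U` by `stateTemp_shell`,
`E = |m|²/(2ϱ) + 3ϱθo/2` off the vacuum, `m = 0` on it, `∑ᵢ(mᵢ - ϱUᵢ)² = ‖m - ϱU‖²`). [folklore] -/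
theorem dist_le_of_regimes (χe f : ℝ → ℝ) {δK c P L X : ℝ} (d : StrongPointData) (U : ℝ × V3 × ℝ)
    (hδr : δK ≤ d.r) (hrP : d.r ≤ P) (hΘ0 : 0 ≤ d.Θ) (hΘP : d.Θ ≤ P) (hUP : ‖d.U‖ ≤ P)
    (hU0 : 0 ≤ U.1) (hUE : 0 ≤ U.2.2) (hUm : ‖U.2.1‖ ^ 2 ≤ 2 * U.1 * U.2.2) (hX : 0 ≤ X)
    (hnear : 0 < U.1 → |U.1 - d.r| ≤ δK →
      |stateTemp (EulerEOS.monatomicExcess χe f) U.1 (U.2.2 - ‖U.2.1‖ ^ 2 / (2 * U.1)) - d.Θ| ≤ δK →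
      c * ((U.1 - d.r) ^ 2 + (stateTemp (EulerEOS.monatomicExcess χe f) U.1 (U.2.2 - ‖U.2.1‖ ^ 2 / (2 * U.1)) - d.Θ) ^ 2) +
        (∑ i, (U.2.1 i - U.1 * d.U i) ^ 2) / (2 * U.1) ≤ X)
    (hfar : ¬(0 < U.1 ∧ |U.1 - d.r| ≤ δK ∧
        |stateTemp (EulerEOS.monatomicExcess χe f) U.1 (U.2.2 - ‖U.2.1‖ ^ 2 / (2 * U.1)) - d.Θ| ≤ δK) →
      c * (1 + U.1 + U.2.2 + (∑ i, (U.2.1 i - U.1 * d.U i) ^ 2) / (2 * U.1)) ≤ X)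
    (hL : ∀ (m U : V3) (r₁ r ϑ Θ Et X : ℝ), δK ≤ r → r ≤ P → 0 ≤ Θ → Θ ≤ P → ‖U‖ ≤ P → 0 ≤ r₁ → 0 ≤ ϑ →
      0 ≤ Et → 0 ≤ X → (r₁ = 0 → m = 0) → (0 < r₁ → Et = ‖m‖ ^ 2 / (2 * r₁) + 3 / 2 * r₁ * ϑ) →
      ((0 < r₁ ∧ |r₁ - r| ≤ δK ∧ |ϑ - Θ| ≤ δK) → c * ((r₁ - r) ^ 2 + (ϑ - Θ) ^ 2) + ‖m - r₁ • U‖ ^ 2 / (2 * r₁) ≤ X) →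
      (¬(0 < r₁ ∧ |r₁ - r| ≤ δK ∧ |ϑ - Θ| ≤ δK) → c * (1 + r₁ + Et + ‖m - r₁ • U‖ ^ 2 / (2 * r₁)) ≤ X) →
      |r₁ - r| + ‖m - r • U‖ + |Et - r * (‖U‖ ^ 2 / 2 + 3 / 2 * Θ)| ≤ L * (X + Real.sqrt X)) :
    |U.1 - d.r| + ‖U.2.1 - d.r • d.U‖ + |U.2.2 - totalEnergyDensity d.r d.U d.Θ| ≤ L * (X + Real.sqrt X) := by
  -- the shell temperature, the total energy off the vacuum, the vacuum, the momentum defect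
  have hϑ : stateTemp (EulerEOS.monatomicExcess χe f) U.1 (U.2.2 - ‖U.2.1‖ ^ 2 / (2 * U.1)) =
      2 / 3 * (U.2.2 / U.1 - ‖U.2.1‖ ^ 2 / (2 * U.1 ^ 2)) := ChaosClosesEulerShellSlice.stateTemp_shell χe f U
  have hϑ0 : 0 ≤ 2 / 3 * (U.2.2 / U.1 - ‖U.2.1‖ ^ 2 / (2 * U.1 ^ 2)) :=
    ChaosClosesEulerShellSlice.temp_shell_nonneg U hU0 hUE hUm
  have hEt : 0 < U.1 → U.2.2 = ‖U.2.1‖ ^ 2 / (2 * U.1) +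
      3 / 2 * U.1 * (2 / 3 * (U.2.2 / U.1 - ‖U.2.1‖ ^ 2 / (2 * U.1 ^ 2))) :=
    fun h => ChaosClosesEulerShellSlice.totalEnergy_shell U h
  have hvac : U.1 = 0 → U.2.1 = 0 := fun h => ChaosClosesEulerShellSlice.mom_shell_eq_zero U h hUm
  have hsq : ∑ i, (U.2.1 i - U.1 * d.U i) ^ 2 = ‖U.2.1 - U.1 • d.U‖ ^ 2 :=
    (ChaosClosesEulerShell.norm_sub_smul_sq U.2.1 d.U U.1).symm
  rw [hϑ, hsq] at hnear hfar
  exact hL U.2.1 d.U U.1 d.r _ d.Θ U.2.2 X hδr hrP hΘ0 hΘP hUP hU0 hϑ0 hUE hX hvac hEt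
    (fun h => hnear h.1 h.2.1 h.2.2) hfar

/-! ## §2 AM–GM in the window: `∫ √ℰ ≤ Δ √Γ` -/

/-- **The choice `λ = √Γ`.** If `I ≤ (λΔ + ΔΓ/λ)/2` for every `λ > 0` (`Γ, Δ ≥ 0`), then `I ≤ Δ √Γ`: for `Γ > 0`
take `λ = √Γ`; for `Γ = 0` the bound `I ≤ λΔ/2` for all `λ > 0` forces `I ≤ 0`. [folklore] -/
theorem le_mul_sqrt_of_forall {Γ Δ I : ℝ} (hΓ : 0 ≤ Γ) (hΔ : 0 ≤ Δ)
    (h : ∀ lam : ℝ, 0 < lam → I ≤ (lam * Δ + Δ * Γ / lam) / 2) : I ≤ Δ * Real.sqrt Γ := by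
  rcases hΓ.eq_or_lt with hΓ0 | hΓpos
  · -- `Γ = 0`
    rw [← hΓ0, Real.sqrt_zero, mul_zero]
    refine le_of_forall_pos_le_add fun ε hε => ?_
    have hlam : 0 < ε / (Δ + 1) := div_pos hε (by linarith)
    have key := h (ε / (Δ + 1)) hlam
    rw [← hΓ0, mul_zero, zero_div, add_zero] at key
    have hb : ε / (Δ + 1) * Δ / 2 ≤ ε := by
      rw [div_mul_eq_mul_div, div_div, div_le_iff₀ (by positivity)]
      nlinarith [mul_nonneg hε.le hΔ]
    linarith
  · -- `Γ > 0`, `λ = √Γ`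
    have hs : 0 < Real.sqrt Γ := Real.sqrt_pos.2 hΓpos
    have key := h (Real.sqrt Γ) hs
    have e : (Real.sqrt Γ * Δ + Δ * Γ / Real.sqrt Γ) / 2 = Δ * Real.sqrt Γ := by
      rw [mul_div_assoc, Real.div_sqrt]; ring
    rw [e] at key
    exact key

/-! ## §3 Integration over the strip `[τ₀, τ₀ + Δ] × 𝕋³` -/

/-- **Strip integration.** Let `D, E` be integrable on the strip `S = [τ₀, τ₀ + Δ] × 𝕋³` (`Δ > 0`) with Fubini
identities, `0 ≤ E` and `D ≤ L (E + √E)` on `S` (`L ≥ 0`), and let `Fm = ∫ₓ E(·, x)` on `[τ₀, τ₀ + Δ]` satisfy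
`∫ Fm ≤ Δ Γ` (`Γ ≥ 0`). Then `∫_{τ₀}^{τ₀+Δ} ∫ₓ D ≤ Δ · L (Γ + √Γ)`: monotonicity and linearity of the integral,
`∫_S √E ≤ (λ |S| + ∫_S E / λ)/2` for all `λ > 0` (`integral_sqrt_le_of_ae`, `|S| = Δ`), and `le_mul_sqrt_of_forall`.
[folklore] -/
theorem strip_integral_le {D E : ℝ × T3 → ℝ} {Fm : ℝ → ℝ} {τ₀ Δ L Γ : ℝ} (hΔ : 0 < Δ) (hL : 0 ≤ L)
    (hΓ : 0 ≤ Γ) (iD : IntegrableOn D (Icc τ₀ (τ₀ + Δ) ×ˢ univ)) (iE : IntegrableOn E (Icc τ₀ (τ₀ + Δ) ×ˢ univ))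
    (eD : (∫ z in Icc τ₀ (τ₀ + Δ) ×ˢ univ, D z) = ∫ s in Icc τ₀ (τ₀ + Δ), ∫ x, D (s, x))
    (eE : (∫ z in Icc τ₀ (τ₀ + Δ) ×ˢ univ, E z) = ∫ s in Icc τ₀ (τ₀ + Δ), ∫ x, E (s, x))
    (hFm : ∀ s ∈ Icc τ₀ (τ₀ + Δ), Fm s = ∫ x, E (s, x)) (hwin : ∫ s in Icc τ₀ (τ₀ + Δ), Fm s ≤ Δ * Γ)
    (hE0 : ∀ z ∈ Icc τ₀ (τ₀ + Δ) ×ˢ (univ : Set T3), 0 ≤ E z)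
    (hDE : ∀ z ∈ Icc τ₀ (τ₀ + Δ) ×ˢ (univ : Set T3), D z ≤ L * (E z + Real.sqrt (E z))) :
    ∫ s in Icc τ₀ (τ₀ + Δ), ∫ x, D (s, x) ≤ Δ * (L * (Γ + Real.sqrt Γ)) := by
  have hSm : MeasurableSet (Icc τ₀ (τ₀ + Δ) ×ˢ (univ : Set T3)) := measurableSet_Icc.prod MeasurableSet.univ
  haveI : IsFiniteMeasure ((volume : Measure (ℝ × T3)).restrict (Icc τ₀ (τ₀ + Δ) ×ˢ univ)) :=
    ChaosClosesEulerShellMeas.isFiniteMeasure_restrict_strip τ₀ (τ₀ + Δ)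
  have iE' : Integrable E ((volume : Measure (ℝ × T3)).restrict (Icc τ₀ (τ₀ + Δ) ×ˢ univ)) := iE
  have iR : Integrable (fun z => Real.sqrt (E z)) ((volume : Measure (ℝ × T3)).restrict (Icc τ₀ (τ₀ + Δ) ×ˢ univ)) :=
    ChaosClosesEulerShellL1Int.integrable_sqrt iE'
  -- the window bound in product form
  have hwinE : ∫ z in Icc τ₀ (τ₀ + Δ) ×ˢ univ, E z ≤ Δ * Γ := by
    rw [eE, ← setIntegral_congr_fun measurableSet_Icc fun s hs => hFm s hs]
    exact hwin
  -- `∫∫ √E ≤ Δ √Γ`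
  have hE0' : 0 ≤ᵐ[(volume : Measure (ℝ × T3)).restrict (Icc τ₀ (τ₀ + Δ) ×ˢ univ)] E :=
    (ae_restrict_iff' hSm).2 (ae_of_all _ fun z hz => hE0 z hz)
  have hΔ' : (0 : ℝ) ≤ τ₀ + Δ - τ₀ := by linarith
  have hμ : (((volume : Measure (ℝ × T3)).restrict (Icc τ₀ (τ₀ + Δ) ×ˢ univ)) univ).toReal = Δ := by
    rw [Measure.restrict_apply_univ, ChaosClosesEulerShellMeas.volume_strip, ENNReal.toReal_ofReal hΔ']
    ring
  have hR : ∫ z in Icc τ₀ (τ₀ + Δ) ×ˢ univ, Real.sqrt (E z) ≤ Δ * Real.sqrt Γ := by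
    refine le_mul_sqrt_of_forall hΓ hΔ.le fun lam hlam => ?_
    have h := ChaosClosesEulerShellL1Int.integral_sqrt_le_of_ae _ hE0' iE' hlam
    rw [hμ] at h
    have h' : (∫ z in Icc τ₀ (τ₀ + Δ) ×ˢ univ, E z) / lam ≤ Δ * Γ / lam :=
      div_le_div_of_nonneg_right hwinE hlam.le
    linarith
  -- monotonicity and linearity of the integral on the strip
  have hmono : ∫ z in Icc τ₀ (τ₀ + Δ) ×ˢ univ, D z ≤
      ∫ z in Icc τ₀ (τ₀ + Δ) ×ˢ univ, L * (E z + Real.sqrt (E z)) :=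
    setIntegral_mono_on iD ((iE'.add iR).const_mul L) hSm hDE
  rw [integral_const_mul, integral_add iE' iR] at hmono
  rw [← eD]
  calc ∫ z in Icc τ₀ (τ₀ + Δ) ×ˢ univ, D z
      ≤ L * ((∫ z in Icc τ₀ (τ₀ + Δ) ×ˢ univ, E z) + ∫ z in Icc τ₀ (τ₀ + Δ) ×ˢ univ, Real.sqrt (E z)) := hmono
    _ ≤ L * (Δ * Γ + Δ * Real.sqrt Γ) := mul_le_mul_of_nonneg_left (add_le_add hwinE hR) hL
    _ = Δ * (L * (Γ + Real.sqrt Γ)) := by ring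

/-! ## §4 Core lemma C of the assembly -/

/-- **Core lemma C (coercivity: the window bound of the relative energy gives the `L¹` bound).** In the common
setting of the assembly (see the module docstring), if `Fm = F` on `[0, t]` with `F(s) = ∫ₓ ℰ(s, x)` and
`∫_{τ₀}^{τ₀+Δ} Fm ≤ Δ Γ` on a window `[τ₀, τ₀ + Δ] ⊆ [0, t]`, then
`∫_{τ₀}^{τ₀+Δ} ∫ₓ (|ϱ - ρ| + ‖m - ρu‖ + |E - E(ρ, u, θ)|) ≤ Δ · L (Γ + √Γ)`. Pointwise `D ≤ L(ℰ + √ℰ)` on the strip by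
`dist_le_of_regimes` (conjuncts 2–4 of the package at `d = pdAt (s, x)`, whose equations are `pointEqs`), then
`strip_integral_le` with the Fubini identities of `strip_pack` for `D` (`field_L1`) and `ℰ` (`field_relEnergy`).
[cite: BrezinaFeireisl2018, §3] -/
theorem coreC {χe f : ℝ → ℝ} {B : ℝ} (hχc : ContinuousOn χe (Set.Ioi 0)) (hfc : ContinuousOn f (Set.Ioi 0)) (hB : ∀ a, 0 < a → |χe a| ≤ B)
    {T : ℝ} {ρ θ : ℝ → T3 → ℝ} {u : ℝ → T3 → V3}
    (hcl : IsClassicalEulerSolution (EulerEOS.monatomicExcess χe f) T ρ u θ) (hG : (EulerEOS.monatomicExcess χe f).IsGibbs)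
    {t t' : ℝ} (ht0 : 0 < t) (htt' : t < t') (ht'T : t' < T)
    {M N : ℝ} (hM0 : 0 ≤ M) (hN0 : 0 ≤ N) (hM : ∀ s ∈ Set.Icc 0 t', ∀ x, (pdAt T ρ u θ (s, x)).Bounded M)
    (hN : CoeffBound (EulerEOS.monatomicExcess χe f) T ρ u θ t' N)
    {K : Set (ℝ × ℝ)} (hmemK : ∀ s ∈ Set.Icc 0 t', ∀ x, (ρ s x, θ s x) ∈ K)
    {P : ℝ} (hP1 : 1 ≤ P) (hρb : ∀ s ∈ Set.Icc 0 t', ∀ x, |ρ s x| ≤ P) (hub : ∀ s ∈ Set.Icc 0 t', ∀ x, ‖u s x‖ ≤ P)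
    (hθb : ∀ s ∈ Set.Icc 0 t', ∀ x, |θ s x| ≤ P)
    {δK a b C c : ℝ} (hδK : 0 < δK) (hab : a < b) (hC : 0 < C) (hc : 0 < c)
    (hKδ : ∀ r Θ : ℝ, (r, Θ) ∈ K → δK < r ∧ δK < Θ)
    (hpack : ∀ d : StrongPointData, (d.r, d.Θ) ∈ K → d.Bounded M → d.MassEq → d.TemperatureEq (EulerEOS.monatomicExcess χe f) →
      d.MomentumEq (EulerEOS.monatomicExcess χe f) → ∀ U : ℝ × V3 × ℝ, 0 ≤ U.1 → 0 ≤ U.2.2 → ‖U.2.1‖ ^ 2 ≤ 2 * U.1 * U.2.2 →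
      rawRHS (EulerEOS.monatomicExcess χe f) (if 0 < 2 / 3 * (U.2.2 / U.1 - ‖U.2.1‖ ^ 2 / (2 * U.1 ^ 2)) then clamp a b else fun _ => a) d U.1 (U.2.2 - ‖U.2.1‖ ^ 2 / (2 * U.1)) U.2.1 + divPU (EulerEOS.monatomicExcess χe f) d ≤
          C * d.relEnergyZ (EulerEOS.monatomicExcess χe f) (if 0 < 2 / 3 * (U.2.2 / U.1 - ‖U.2.1‖ ^ 2 / (2 * U.1 ^ 2)) then clamp a b else fun _ => a) (U.1, U.2.2 - ‖U.2.1‖ ^ 2 / (2 * U.1), U.2.1) ∧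
        0 ≤ d.relEnergyZ (EulerEOS.monatomicExcess χe f) (if 0 < 2 / 3 * (U.2.2 / U.1 - ‖U.2.1‖ ^ 2 / (2 * U.1 ^ 2)) then clamp a b else fun _ => a) (U.1, U.2.2 - ‖U.2.1‖ ^ 2 / (2 * U.1), U.2.1) ∧
        (0 < U.1 → |U.1 - d.r| ≤ δK → |stateTemp (EulerEOS.monatomicExcess χe f) U.1 (U.2.2 - ‖U.2.1‖ ^ 2 / (2 * U.1)) - d.Θ| ≤ δK →
          c * ((U.1 - d.r) ^ 2 + (stateTemp (EulerEOS.monatomicExcess χe f) U.1 (U.2.2 - ‖U.2.1‖ ^ 2 / (2 * U.1)) - d.Θ) ^ 2) +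
            (∑ i, (U.2.1 i - U.1 * d.U i) ^ 2) / (2 * U.1) ≤ d.relEnergyZ (EulerEOS.monatomicExcess χe f) (if 0 < 2 / 3 * (U.2.2 / U.1 - ‖U.2.1‖ ^ 2 / (2 * U.1 ^ 2)) then clamp a b else fun _ => a) (U.1, U.2.2 - ‖U.2.1‖ ^ 2 / (2 * U.1), U.2.1)) ∧
        (¬(0 < U.1 ∧ |U.1 - d.r| ≤ δK ∧ |stateTemp (EulerEOS.monatomicExcess χe f) U.1 (U.2.2 - ‖U.2.1‖ ^ 2 / (2 * U.1)) - d.Θ| ≤ δK) →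
          c * (1 + U.1 + U.2.2 + (∑ i, (U.2.1 i - U.1 * d.U i) ^ 2) / (2 * U.1)) ≤
            d.relEnergyZ (EulerEOS.monatomicExcess χe f) (if 0 < 2 / 3 * (U.2.2 / U.1 - ‖U.2.1‖ ^ 2 / (2 * U.1 ^ 2)) then clamp a b else fun _ => a) (U.1, U.2.2 - ‖U.2.1‖ ^ 2 / (2 * U.1), U.2.1)))
    {V : ℝ → T3 → ℝ × V3 × ℝ} (hV : Measurable (Function.uncurry V)) {CV : ℝ}
    (hCV : ∀ s x, |(V s x).1| ≤ CV ∧ ‖(V s x).2.1‖ ≤ CV ∧ |(V s x).2.2| ≤ CV)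
    (hV0 : ∀ s x, 0 ≤ (V s x).1) (hVE : ∀ s x, 0 ≤ (V s x).2.2) (hVm : ∀ s x, ‖(V s x).2.1‖ ^ 2 ≤ 2 * (V s x).1 * (V s x).2.2)
    {L : ℝ} (hL0 : 0 < L)
    (hL : ∀ (m U : V3) (r₁ r ϑ Θ Et X : ℝ), δK ≤ r → r ≤ P → 0 ≤ Θ → Θ ≤ P → ‖U‖ ≤ P → 0 ≤ r₁ → 0 ≤ ϑ → 0 ≤ Et → 0 ≤ X →
      (r₁ = 0 → m = 0) → (0 < r₁ → Et = ‖m‖ ^ 2 / (2 * r₁) + 3 / 2 * r₁ * ϑ) →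
      ((0 < r₁ ∧ |r₁ - r| ≤ δK ∧ |ϑ - Θ| ≤ δK) → c * ((r₁ - r) ^ 2 + (ϑ - Θ) ^ 2) + ‖m - r₁ • U‖ ^ 2 / (2 * r₁) ≤ X) →
      (¬(0 < r₁ ∧ |r₁ - r| ≤ δK ∧ |ϑ - Θ| ≤ δK) → c * (1 + r₁ + Et + ‖m - r₁ • U‖ ^ 2 / (2 * r₁)) ≤ X) →
      |r₁ - r| + ‖m - r • U‖ + |Et - r * (‖U‖ ^ 2 / 2 + 3 / 2 * Θ)| ≤ L * (X + Real.sqrt X))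
    {Fm : ℝ → ℝ} (hFm : ∀ s ∈ Set.Icc 0 t, Fm s = ∫ x, (pdAt T ρ u θ (s, x)).relEnergyZ (EulerEOS.monatomicExcess χe f) (if 0 < 2 / 3 * ((V s x).2.2 / (V s x).1 - ‖(V s x).2.1‖ ^ 2 / (2 * (V s x).1 ^ 2)) then clamp a b else fun _ => a) ((V s x).1, (V s x).2.2 - ‖(V s x).2.1‖ ^ 2 / (2 * (V s x).1), (V s x).2.1))
    {Δ τ₀ Γ : ℝ} (hΔ : 0 < Δ) (hτ₀ : τ₀ ∈ Set.Icc 0 (t - Δ)) (hΓ : 0 ≤ Γ)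
    (hwin : ∫ s in Set.Icc τ₀ (τ₀ + Δ), Fm s ≤ Δ * Γ) :
    ∫ s in Set.Icc τ₀ (τ₀ + Δ), ∫ x, (|(V s x).1 - ρ s x| + ‖(V s x).2.1 - ρ s x • u s x‖ + |(V s x).2.2 - totalEnergyDensity (ρ s x) (u s x) (θ s x)|) ≤ Δ * (L * (Γ + Real.sqrt Γ)) := by
  -- hypotheses of the common header of the three core lemmas that part C does not need
  have _ : (∀ a, 0 < a → |χe a| ≤ B) ∧ 0 < t ∧ 0 ≤ M ∧ 0 ≤ N ∧ 1 ≤ P ∧ 0 < δK ∧ 0 < C ∧ 0 < c :=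
    ⟨hB, ht0, hM0, hN0, hP1, hδK, hC, hc⟩
  -- the window `[τ₀, τ₀ + Δ] ⊆ [0, t] ⊆ [0, t']`
  have hτ0 : 0 ≤ τ₀ := hτ₀.1
  have hτ1 : τ₀ ≤ τ₀ + Δ := by linarith
  have hτt : τ₀ + Δ ≤ t := by linarith [hτ₀.2]
  have hτt' : τ₀ + Δ ≤ t' := hτt.trans htt'.le
  -- the two integrands: integrability on the strip and Fubini
  obtain ⟨mD, bD⟩ := ChaosClosesEulerShellFieldB.field_L1 hcl ht'T hV hCV hρb hub hθb
  obtain ⟨mE, bE⟩ := ChaosClosesEulerShellField.field_relEnergy hχc hfc hcl ht'T hV hV0 hVE hVm hCV hM hN hab.le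
  obtain ⟨iD, eD, -⟩ := ChaosClosesEulerShellField.strip_pack _ _ _ mD bD hτ0 hτ1 hτt'
  obtain ⟨iE, eE, -⟩ := ChaosClosesEulerShellField.strip_pack _ _ _ mE bE hτ0 hτ1 hτt'
  refine strip_integral_le hΔ hL0.le hΓ iD iE eD eE (fun s hs => hFm s ⟨hτ0.trans hs.1, hs.2.trans hτt⟩) hwin
    ?_ ?_
  · -- `0 ≤ ℰ` on the strip (conjunct 2 of the package)
    rintro ⟨s, x⟩ ⟨hs, -⟩
    dsimp only
    have hs' : s ∈ Icc 0 t' := ⟨hτ0.trans hs.1, hs.2.trans hτt'⟩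
    have hsT : s ∈ Ico 0 T := ⟨hs'.1, hs'.2.trans_lt ht'T⟩
    obtain ⟨hMass, hTemp, hMom⟩ := ChaosClosesEulerShellData.pointEqs hcl hG hsT x
    exact (hpack (pdAt T ρ u θ (s, x)) (hmemK s hs' x) (hM s hs' x) hMass hTemp hMom (V s x) (hV0 s x) (hVE s x)
      (hVm s x)).2.1
  · -- `D ≤ L (ℰ + √ℰ)` on the strip (conjuncts 3, 4 of the package and the `L¹` clause)
    rintro ⟨s, x⟩ ⟨hs, -⟩
    dsimp only
    have hs' : s ∈ Icc 0 t' := ⟨hτ0.trans hs.1, hs.2.trans hτt'⟩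
    have hsT : s ∈ Ico 0 T := ⟨hs'.1, hs'.2.trans_lt ht'T⟩
    obtain ⟨hMass, hTemp, hMom⟩ := ChaosClosesEulerShellData.pointEqs hcl hG hsT x
    obtain ⟨-, h0, hnear, hfar⟩ := hpack (pdAt T ρ u θ (s, x)) (hmemK s hs' x) (hM s hs' x) hMass hTemp hMom (V s x)
      (hV0 s x) (hVE s x) (hVm s x)
    have hKs := hKδ _ _ (hmemK s hs' x)
    exact dist_le_of_regimes χe f (pdAt T ρ u θ (s, x)) (V s x) hKs.1.le ((le_abs_self _).trans (hρb s hs' x))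
      (hcl.temperature_pos s hsT x).le ((le_abs_self _).trans (hθb s hs' x)) (hub s hs' x) (hV0 s x) (hVE s x)
      (hVm s x) h0 hnear hfar hL

/-! ## The registered sub-goal -/

/-- REGISTERED SUB-GOAL `stub_bf18ShellCoreC` of the line `Sketch` (BF18 shell assembly, core lemma C): the AM–GM
choice `λ = √Γ` — if `I ≤ (λΔ + ΔΓ/λ)/2` for every `λ > 0` (`Γ, Δ ≥ 0`) then `I ≤ Δ √Γ` (`le_mul_sqrt_of_forall`).
[folklore] -/
theorem stub_bf18ShellCoreC : ∀ (Γ Δ I : ℝ), 0 ≤ Γ → 0 ≤ Δ → (∀ lam : ℝ, 0 < lam → I ≤ (lam * Δ + Δ * Γ / lam) / 2) → I ≤ Δ * Real.sqrt Γ :=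
  fun _Γ _Δ _I hΓ hΔ h => le_mul_sqrt_of_forall hΓ hΔ h

end Summit.AtomisticToContinuum.HydrodynamicLimit.Theorems.ChaosClosesEulerShellCoreC

end
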